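import Summits.Ventures.WeilGRH.TwistedWindowClosure
import Summits.RiemannHypothesis.RiemannHypothesis.Theorems.WeilBochnerMeasureWindow
import HarnessLib

/-!
# GRH arm (rh-explicit, venture WeilGRH): a `χ`-window measure represents the TWISTED WINDOW FORM on
  Yoshida's window functions

Cell `rh-explicit`, WEIL TRACK (structure seat weil-3, gen9) for the GRH ARM.  The `χ`-twin of the
structure seat's `WeilBochnerMeasureWindow.lean` (the case `L = ζ`) and the measure-side companion of
`TwistedWindowClosure.lean`.

Let `χ` be a Dirichlet character mod `q ≠ 1`, `a > 0`, and let `μ` be ANY positive measure representing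
the twisted Weil form on the smooth cone `C(a)`:
`‖ĝ(½+it)‖² ∈ L¹(μ)` and `Q_χ(g) = W_χ(g ⋆ g̃) = ∫ ‖ĝ(½+it)‖² dμ(t)` for all tests `g` supported in
`[-a, a]` (such `μ` exist iff the rung `WeilPositivityOnChar χ a` holds,
`WeilBochnerChar.weilPositivityOnChar_iff_exists_measure`; under `GRH(χ)` the zero heights of `L(s, χ)`
serve at every window, `WeilBochner.weilQuadraticChar_eq_integral_of_riemannHypothesis`).  Assume
`(1 + t²)⁻¹ ∈ L¹(μ)` (true for the zero-height measure of a primitive `χ`,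
`CharZeroSum.summable_zeroOrder_div_one_add_sq`; for `ζ`-window measures it is the growth law
`WeilBochnerMeasureGrowth.integrable_inv_one_add_sq`).  Then the representation extends from `C(a)` to
every WINDOW FUNCTION `u` on `[-a, a]` that is smooth inside the closed window (jumps at `±a` allowed —
Yoshida's `K(a)`, the trigonometric windows `Σ c_n χ_n`, the flat window `𝟙_{[-a,a]}`):

  `𝓔^χ_a(u) − M^χ_a ‖u‖₂² = ∫ ‖û(½+it)‖² dμ(t)`,  `‖û(½+it)‖² ∈ L¹(μ)`
  (`twistedWindowForm_eq_integral`; `𝓔^χ_a`/`M^χ_a` = the twisted Markov decomposition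
  `Re Q_χ(g) = 𝓔^χ_a(g) − M^χ_a‖g‖₂²` of `WeilMarkovQuadraticChar.lean`).

So the twisted format-C Gram truncations are moment matrices of `μ` (`twistedWindowForm_sum_smul_chi_eq_integral`)
and — the point of the sequel `FlatWindowSpectral.lean` — the FLAT-WINDOW inequality of
`TwistedFlatTest.lean` becomes an IDENTITY with an explicit non-negative spectral remainder.

Proof: verbatim the `ζ` proof (cut `u` off smoothly inside the window, `g_k = η_k · u ∈ C(a)`; Q-side
`tendsto_twistedWindowForm_of_ae_tendsto_of_le`; μ-side dominated convergence with
`‖ĝ_k(½+it)‖² ≤ B(1+t²)⁻¹` uniformly in `k` from `∫‖g_k′‖ ≤ 4CS₀ + 2a‖f′‖_∞`).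

No definitions, no named facts, RH/GRH-free.

## References

* H. Yoshida, *On Hermitian forms attached to zeta functions*, Adv. Stud. Pure Math. 21 (1992) 281–325,
  §0 (extension of the form to `K(a)`), §3 (the basis `χ_n`). [Yoshida1992]
* A. Weil, *Sur les "formules explicites" de la théorie des nombres premiers* (1952), (11) pp. 261–262 and
  the «lemme» p. 262. [Weil1952FormulesExplicites]
-/

set_option autoImplicit false

noncomputable section

open Complex Filter Set MeasureTheory
open scoped Real Topology ComplexConjugate ContDiff ArithmeticFunction.vonMangoldt

namespace Summit.Ventures.WeilGRH

open Literature.NumberTheory.LFunctions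
open Literature.NumberTheory.LFunctions.Yoshida1992 (chi chiCore contDiff_chiCore)
open Summit.RiemannHypothesis.RiemannHypothesis.Theorems.WeilFormatC
open Summit.RiemannHypothesis.RiemannHypothesis.Theorems.WeilBochnerMeasure

variable {q : ℕ} {a : ℝ}

/-- **A `χ`-window measure represents the twisted window form on Yoshida's window functions.**  Let
`q ≠ 1`, `a > 0`, let `μ` represent `Q_χ` on the tests supported in `[-a, a]`
(`‖ĝ(½+it)‖² ∈ L¹(μ)`, `Q_χ(g) = ∫ ‖ĝ(½+it)‖² dμ`) with `(1 + t²)⁻¹ ∈ L¹(μ)`.  Then for every window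
function `u` on `[-a, a]` (measurable, `0` off the window, bounded, Lipschitz on the closed window) that
agrees on `[-a, a]` with a smooth `f` — jumps at `±a` allowed — the transform density `‖û(½+it)‖²` is
`μ`-integrable and

  `𝓔^χ_a(u) − M^χ_a‖u‖₂² = ∫ ‖û(½+it)‖² dμ(t)`. -/
theorem twistedWindowForm_eq_integral (hq : q ≠ 1) (χ : DirichletCharacter ℂ q) (ha : 0 < a)
    {μ : Measure ℝ}
    (hμ : ∀ g : ℝ → ℂ, IsWeilTest g → tsupport g ⊆ Icc (-a) a →
      Integrable (fun t : ℝ ↦ ‖weilMellin g (1 / 2 + t * I)‖ ^ 2) μ ∧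
        weilQuadraticChar χ g = ((∫ t, ‖weilMellin g (1 / 2 + t * I)‖ ^ 2 ∂μ : ℝ) : ℂ))
    (hI : Integrable (fun t : ℝ ↦ (1 + t ^ 2)⁻¹) μ)
    {u f : ℝ → ℂ} (hu : IsWindowFunction a u) (hf : ContDiff ℝ ∞ f) (huf : ∀ x ∈ Icc (-a) a, u x = f x) :
    Integrable (fun t : ℝ ↦ ‖weilMellin u (1 / 2 + t * I)‖ ^ 2) μ ∧
      weilDirichletEnergyChar χ a u - weilMarkovConstantChar χ a * (∫ x : ℝ, ‖u x‖ ^ 2) =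
        ∫ t, ‖weilMellin u (1 / 2 + t * I)‖ ^ 2 ∂μ := by
  obtain ⟨hum, huz, ⟨S₀, hS₀⟩, ⟨S₁', hS₁'⟩⟩ := hu
  set S₁ := max S₁' 0 with hS₁def
  have hS₁0 : 0 ≤ S₁ := le_max_right _ _
  have hS₁ : ∀ x y, x ∈ Icc (-a) a → y ∈ Icc (-a) a → ‖u y - u x‖ ≤ S₁ * |y - x| := fun x y hx hy ↦
    (hS₁' x y hx hy).trans (mul_le_mul_of_nonneg_right (le_max_left _ _) (abs_nonneg _))
  have hS₀0 : 0 ≤ S₀ := (norm_nonneg _).trans (hS₀ 0)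
  obtain ⟨C, hC0, hC⟩ := exists_lipschitz_smoothTransition
  -- transition widths `ε_k = a/(2(k+2)) → 0`, `2ε_k ≤ a`
  set ε : ℕ → ℝ := fun k ↦ a / ((k : ℝ) + 2) / 2 with hεdef
  have hε : ∀ k, 0 < ε k := fun k ↦ by positivity
  have h2ε : ∀ k, 2 * ε k ≤ a := fun k ↦ by
    have : a / ((k : ℝ) + 2) ≤ a := div_le_self ha.le (by linarith [(Nat.cast_nonneg k : (0 : ℝ) ≤ k)])
    show 2 * (a / ((k : ℝ) + 2) / 2) ≤ a
    linarith
  have hεto : Tendsto ε atTop (𝓝 0) := by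
    have h1 : Tendsto (fun k : ℕ ↦ a / ((k : ℝ) + 2)) atTop (𝓝 0) :=
      tendsto_const_nhds.div_atTop (tendsto_atTop_add_const_right _ _ tendsto_natCast_atTop_atTop)
    simpa [hεdef] using h1.div_const 2
  choose η hηs hη01 hη1 hη0 hηL using fun k ↦ exists_smooth_plateau (a := a) (hε k) hC
  have hηm : ∀ k, Measurable (η k) := fun k ↦ (hηs k).continuous.measurable
  -- the approximants `g_k = η_k · f = η_k · u ∈ C(a)`
  set g : ℕ → ℝ → ℂ := fun k x ↦ (η k x : ℂ) * f x with hgdef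
  have hgu : ∀ k x, g k x = (η k x : ℂ) * u x := by
    intro k x
    by_cases hx : x ∈ Icc (-a) a
    · simp only [hgdef, huf x hx]
    · have hxa : a - ε k ≤ |x| := by
        have : a < |x| := lt_abs_of_not_mem_Icc_window hx
        linarith [hε k]
      simp only [hgdef, hη0 k x hxa, Complex.ofReal_zero, zero_mul]
  have hgu' : ∀ k, g k = fun x ↦ (η k x : ℂ) * u x := fun k ↦ funext (hgu k)
  have hgz : ∀ k x, x ∉ Icc (-a) a → g k x = 0 := fun k x hx ↦ by rw [hgu, huz x hx, mul_zero]
  have hgb : ∀ k x, ‖g k x‖ ≤ S₀ := fun k x ↦ by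
    rw [hgu, norm_mul, Complex.norm_real, Real.norm_eq_abs, abs_of_nonneg (hη01 k x).1]
    calc η k x * ‖u x‖ ≤ 1 * S₀ := by
          gcongr
          · exact (hη01 k x).2
          · exact hS₀ x
      _ = S₀ := one_mul _
  have hofR : ContDiff ℝ ∞ (fun x : ℝ ↦ (x : ℂ)) := Complex.ofRealCLM.contDiff
  have hgsmooth : ∀ k, ContDiff ℝ ∞ (g k) := fun k ↦ (hofR.comp (hηs k)).mul hf
  have hgm : ∀ k, Measurable (g k) := fun k ↦ (hgsmooth k).continuous.measurable
  have hgsupp : ∀ k, tsupport (g k) ⊆ Icc (-a) a := fun k ↦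
    closure_minimal (fun x hx ↦ by_contra fun h ↦ hx (hgz k x h)) isClosed_Icc
  have hgtest : ∀ k, IsWeilTest (g k) := fun k ↦
    ⟨hgsmooth k, HasCompactSupport.intro isCompact_Icc (hgz k)⟩
  -- almost-everywhere convergence `g_k → u` (everywhere off `{a, −a}`)
  have hpt : ∀ᵐ x : ℝ, Tendsto (fun k ↦ g k x) atTop (𝓝 (u x)) := by
    have hnull : ∀ᵐ x : ℝ, x ∈ ({a, -a} : Set ℝ)ᶜ :=
      compl_mem_ae_iff.2 ((Set.toFinite _).measure_zero _)
    refine hnull.mono fun x hx ↦ ?_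
    simp only [mem_compl_iff, mem_insert_iff, mem_singleton_iff, not_or] at hx
    rcases lt_or_ge a |x| with hxa | hxa
    · have hx' : x ∉ Icc (-a) a := fun h ↦ by
        have := abs_le.2 ⟨h.1, h.2⟩; linarith
      rw [huz x hx']
      exact tendsto_const_nhds.congr' (Eventually.of_forall fun k ↦ (hgz k x hx').symm)
    · have hlt : |x| < a := lt_of_le_of_ne hxa fun h ↦ by
        rcases (abs_eq ha.le).1 h with h' | h'
        · exact hx.1 h'
        · exact hx.2 h'
      have hr : (0 : ℝ) < (a - |x|) / 2 := by linarith
      have hev : ∀ᶠ k in atTop, u x = g k x := by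
        filter_upwards [hεto.eventually (gt_mem_nhds hr)] with k hk
        rw [hgu, hη1 k x (by linarith), Complex.ofReal_one, one_mul]
      exact tendsto_const_nhds.congr' hev
  -- (Q) the twisted window form converges along `g_k → u` (uniform increment bound of the closure files)
  have hQlim : Tendsto (fun k ↦ weilDirichletEnergyChar χ a (g k) -
      weilMarkovConstantChar χ a * ∫ x : ℝ, ‖g k x‖ ^ 2) atTop
      (𝓝 (weilDirichletEnergyChar χ a u - weilMarkovConstantChar χ a * ∫ x : ℝ, ‖u x‖ ^ 2)) := by
    set Lam : ℝ := a * S₁ + 2 * C * S₀ with hLam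
    set K₁ : ℝ := 4 * a * S₁ ^ 2 + 4 * S₀ ^ 2 + 8 * (2 * Lam ^ 2 + 10 * S₀ ^ 2) with hK₁
    set K₂ : ℝ := 8 * a * S₀ ^ 2 with hK₂
    set cst : ℝ := max (K₁ / 2) (K₂ / (8 * a)) with hcst
    have hdom : ∀ k t, 0 < t → weilIncrement (g k) t ≤ cst * (if t ≤ 1 then 2 * t else 8 * a) := by
      intro k t ht
      by_cases ht1 : t ≤ 1
      · rw [if_pos ht1]
        have hmain := weilIncrement_cutoff_le ha (hε k) (h2ε k) hum huz hS₀ hS₁ hS₁0 hC0 (hηm k) (hη01 k)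
          (hη1 k) (hηL k) ht
        rw [← hgu' k] at hmain
        have ht2 : t ^ 2 ≤ t := by nlinarith
        have h3 : 4 * a * S₁ ^ 2 * t ^ 2 ≤ 4 * a * S₁ ^ 2 * t := mul_le_mul_of_nonneg_left ht2 (by positivity)
        calc weilIncrement (g k) t ≤ K₁ * t := by
              rw [hK₁, hLam]; linarith [hmain, h3]
          _ = K₁ / 2 * (2 * t) := by ring
          _ ≤ cst * (2 * t) := by gcongr; exact le_max_left _ _
      · rw [if_neg ht1]
        calc weilIncrement (g k) t ≤ 8 * a * S₀ ^ 2 := weilIncrement_le_window_const ha.le (hgm k) (hgz k) (hgb k) t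
          _ = K₂ / (8 * a) * (8 * a) := by rw [hK₂]; field_simp
          _ ≤ cst * (8 * a) := by gcongr; exact le_max_right _ _
    have hM : IntegrableOn (fun t ↦ weilArchDensity t * (cst * (if t ≤ 1 then 2 * t else 8 * a))) (Ioi 0) := by
      have h0 := integrableOn_archBound ha.le (1 : ℝ) (0 : ℝ)
      have h1 : IntegrableOn (fun t : ℝ ↦ weilArchDensity t * (if t ≤ 1 then 2 * t else 8 * a)) (Ioi 0) :=
        h0.congr_fun (fun t _ ↦ by norm_num) measurableSet_Ioi
      exact IntegrableOn.congr_fun (h1.const_mul cst) (fun t _ ↦ by ring) measurableSet_Ioi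
    exact tendsto_twistedWindowForm_of_ae_tendsto_of_le χ hgm hgz hgb hpt hM hdom a
  -- for each `k`: `𝓔^χ_a(g_k) − M^χ_a‖g_k‖² = Re Q_χ(g_k) = ∫ ‖ĝ_k‖² dμ`
  set F : (ℝ → ℂ) → ℝ → ℝ := fun v t ↦ ‖weilMellin v (1 / 2 + t * I)‖ ^ 2 with hF
  have hk : ∀ k, Integrable (F (g k)) μ ∧
      weilDirichletEnergyChar χ a (g k) - weilMarkovConstantChar χ a * (∫ x : ℝ, ‖g k x‖ ^ 2) =
        ∫ t, F (g k) t ∂μ := fun k ↦ by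
    obtain ⟨h1, h2⟩ := hμ (g k) (hgtest k) (hgsupp k)
    refine ⟨h1, ?_⟩
    rw [← re_weilQuadraticChar_eq_markov_of_ne_one hq χ (hgtest k) (hgsupp k), h2, Complex.ofReal_re]
  -- (μ) uniform bounds on the transforms: `‖ĝ_k‖ ≤ 2aS₀` and `|t|‖ĝ_k‖ ≤ V`
  have hf1 : Differentiable ℝ f := hf.differentiable (by simp)
  have hfd : Continuous (deriv f) := hf.continuous_deriv (by simp)
  obtain ⟨D, hD⟩ := isCompact_Icc.exists_bound_of_continuousOn (hfd.continuousOn (s := Icc (-a) a))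
  have hfS : ∀ x ∈ Icc (-a) a, ‖f x‖ ≤ S₀ := fun x hx ↦ by rw [← huf x hx]; exact hS₀ x
  set V : ℝ := 4 * C * S₀ + D * (2 * a) with hV
  have hVk : ∀ k (t : ℝ), |t| * ‖weilMellin (g k) (1 / 2 + t * I)‖ ≤ V := by
    intro k t
    have hint : Integrable fun x ↦ ‖deriv (g k) x‖ :=
      ((hgtest k).deriv.1.continuous.norm).integrable_of_hasCompactSupport (hgtest k).deriv.2.norm
    have h := integral_norm_deriv_cutoff_le (hε k) (h2ε k) ((hηs k).differentiable (by simp)) (hη01 k)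
      (hη1 k) (hη0 k) (by positivity : 0 ≤ 2 * C / ε k) (hηL k) hf1 hfS hD hint
    have e : 2 * C / ε k * S₀ * (2 * ε k) = 4 * C * S₀ := by
      have hεk := (hε k).ne'
      field_simp
      ring
    rw [e] at h
    exact (abs_mul_norm_weilMellin_le (hgtest k) t).trans h
  have hvol : (volume (Icc (-a) a)).toReal = 2 * a := by
    rw [Real.volume_Icc, ENNReal.toReal_ofReal (by linarith)]; ring
  have hPk : ∀ k (t : ℝ), ‖weilMellin (g k) (1 / 2 + t * I)‖ ≤ S₀ * (2 * a) := by
    intro k t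
    refine (norm_weilMellin_line_le_integral_norm (hgtest k).1.continuous (hgtest k).2 t).trans ?_
    rw [← setIntegral_eq_integral_of_forall_compl_eq_zero (s := Icc (-a) a)
      (fun x hx ↦ by rw [hgz k x hx, norm_zero]), ← hvol]
    have h := norm_setIntegral_le_of_norm_le_const (μ := volume) (s := Icc (-a) a) (f := fun x ↦ ‖g k x‖)
      (C := S₀) (by rw [Real.volume_Icc]; exact ENNReal.ofReal_lt_top) fun x _ ↦ by
        rw [norm_norm]; exact hgb k x
    exact (Real.le_norm_self _).trans h
  set B : ℝ := 2 * max ((S₀ * (2 * a)) ^ 2) (V ^ 2) with hB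
  have hdomμ : ∀ k t, F (g k) t ≤ B * (1 + t ^ 2)⁻¹ := fun k t ↦
    sq_norm_le_of_le_of_abs_mul_le (hPk k t) (hVk k t)
  -- pointwise convergence of the transforms
  have hptM : ∀ t : ℝ, Tendsto (fun k ↦ weilMellin (g k) (1 / 2 + t * I)) atTop
      (𝓝 (weilMellin u (1 / 2 + t * I))) := fun t ↦ by
    unfold weilMellin
    exact tendsto_integral_mul_of_ae_tendsto (by fun_prop) hgm hgz hgb hpt
  have hptF : ∀ t : ℝ, Tendsto (fun k ↦ F (g k) t) atTop (𝓝 (F u t)) := fun t ↦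
    ((hptM t).norm).pow 2
  -- the limit density is measurable and dominated, hence integrable
  have hFm : ∀ k, AEStronglyMeasurable (F (g k)) μ := fun k ↦ by
    have h1 : Continuous fun t : ℝ ↦ (1 / 2 : ℂ) + t * I := by fun_prop
    exact (((continuous_weilMellin (hgtest k).1.continuous (hgtest k).2).comp h1).norm.pow 2).aestronglyMeasurable
  have hFum : AEStronglyMeasurable (F u) μ :=
    aestronglyMeasurable_of_tendsto_ae atTop hFm (ae_of_all _ hptF)
  have hBi : Integrable (fun t : ℝ ↦ B * (1 + t ^ 2)⁻¹) μ := hI.const_mul B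
  have hFu_le : ∀ t, F u t ≤ B * (1 + t ^ 2)⁻¹ := fun t ↦
    le_of_tendsto' (hptF t) fun k ↦ hdomμ k t
  have hF0 : ∀ v t, 0 ≤ F v t := fun v t ↦ by positivity
  have hFui : Integrable (F u) μ :=
    hBi.mono' hFum (ae_of_all _ fun t ↦ by rw [Real.norm_of_nonneg (hF0 u t)]; exact hFu_le t)
  -- dominated convergence on the μ-side and conclusion
  have hμlim : Tendsto (fun k ↦ ∫ t, F (g k) t ∂μ) atTop (𝓝 (∫ t, F u t ∂μ)) :=
    tendsto_integral_of_dominated_convergence (fun t ↦ B * (1 + t ^ 2)⁻¹) hFm hBi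
      (fun k ↦ ae_of_all _ fun t ↦ by rw [Real.norm_of_nonneg (hF0 _ t)]; exact hdomμ k t)
      (ae_of_all _ hptF)
  refine ⟨hFui, tendsto_nhds_unique hQlim ?_⟩
  exact hμlim.congr' (Eventually.of_forall fun k ↦ (hk k).2.symm)

/-- **Yoshida's window functions** (`φ ∈ K(a)`): `𝓔^χ_a(φ) − M^χ_a‖φ‖₂² = ∫ ‖φ̂(½+it)‖² dμ`. -/
theorem twistedWindowForm_eq_integral_of_mem_K (hq : q ≠ 1) (χ : DirichletCharacter ℂ q) (ha : 0 < a)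
    {μ : Measure ℝ}
    (hμ : ∀ g : ℝ → ℂ, IsWeilTest g → tsupport g ⊆ Icc (-a) a →
      Integrable (fun t : ℝ ↦ ‖weilMellin g (1 / 2 + t * I)‖ ^ 2) μ ∧
        weilQuadraticChar χ g = ((∫ t, ‖weilMellin g (1 / 2 + t * I)‖ ^ 2 ∂μ : ℝ) : ℂ))
    (hI : Integrable (fun t : ℝ ↦ (1 + t ^ 2)⁻¹) μ) {φ : ℝ → ℂ} (hφ : φ ∈ Yoshida1992.K a) :
    Integrable (fun t : ℝ ↦ ‖weilMellin φ (1 / 2 + t * I)‖ ^ 2) μ ∧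
      weilDirichletEnergyChar χ a φ - weilMarkovConstantChar χ a * (∫ x : ℝ, ‖φ x‖ ^ 2) =
        ∫ t, ‖weilMellin φ (1 / 2 + t * I)‖ ^ 2 ∂μ := by
  have hwin := isWindowFunction_of_mem_K hφ
  obtain ⟨f, hf, -, hφf, -⟩ := hφ
  exact twistedWindowForm_eq_integral hq χ ha hμ hI hwin hf fun x hx ↦ hφf x (abs_le.2 ⟨hx.1, hx.2⟩)

/-- **Trigonometric windows**: for every finite set of modes `s` and coefficients `c`, the twisted window
form of `Σ_{n∈s} c_n χ_n` is `∫ ‖(Σ c_n χ_n)^(½+it)‖² dμ(t)` — the twisted format-C Gram truncations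
(`TwistedWindowGram.lean`) are MOMENT MATRICES of every representing measure. -/
theorem twistedWindowForm_sum_smul_chi_eq_integral (hq : q ≠ 1) (χ : DirichletCharacter ℂ q)
    (ha : 0 < a) {μ : Measure ℝ}
    (hμ : ∀ g : ℝ → ℂ, IsWeilTest g → tsupport g ⊆ Icc (-a) a →
      Integrable (fun t : ℝ ↦ ‖weilMellin g (1 / 2 + t * I)‖ ^ 2) μ ∧
        weilQuadraticChar χ g = ((∫ t, ‖weilMellin g (1 / 2 + t * I)‖ ^ 2 ∂μ : ℝ) : ℂ))
    (hI : Integrable (fun t : ℝ ↦ (1 + t ^ 2)⁻¹) μ) (s : Finset ℤ) (c : ℤ → ℂ) :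
    Integrable (fun t : ℝ ↦ ‖weilMellin (∑ n ∈ s, c n • chi a n) (1 / 2 + t * I)‖ ^ 2) μ ∧
      weilDirichletEnergyChar χ a (∑ n ∈ s, c n • chi a n) -
          weilMarkovConstantChar χ a * (∫ x : ℝ, ‖(∑ n ∈ s, c n • chi a n) x‖ ^ 2) =
        ∫ t, ‖weilMellin (∑ n ∈ s, c n • chi a n) (1 / 2 + t * I)‖ ^ 2 ∂μ := by
  refine twistedWindowForm_eq_integral hq χ ha hμ hI (f := fun x ↦ ∑ n ∈ s, c n • chiCore a n x)
    (IsWindowFunction.sum s c fun n _ ↦ isWindowFunction_chi ha n)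
    (ContDiff.sum fun n _ ↦ (contDiff_chiCore a n).const_smul (c n)) fun x hx ↦ ?_
  simp only [Finset.sum_apply, Pi.smul_apply, chi, indicator_of_mem hx]

end Summit.Ventures.WeilGRH

end
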